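import Literature.Topology.FourManifolds.ReducibleTrisectionNonSeparatingPi1Charts
import HarnessLib

/-!
# The `π₁`-obstruction to a non-separating reducing curve, from PER-DISC flat charts of the
# central surface

Topic `Literature/Topology/FourManifolds`; continuation of
`ReducibleTrisectionNonSeparatingPi1Charts.lean`
(`IsGKTrisection.not_simplyConnectedSpace_of_sideCharts`: the `π₁`-shadow
"`X = X′ # (S¹ × S³)` forces `π₁(X) ≠ 1`" of Aranda–Zupan's splitting of a trisection along a
NON-SEPARATING reducing curve `δ`, arXiv:2503.04607 §2 p. 6, assembled from side functions `sd_q`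
of the three compressing discs and, at every point `p ∈ δ`, ONE flat chart `e` of the central
surface `F` straightening `δ` in which ALL THREE side functions have a sign pattern
`sd_q = ±ε_q` on `{e₂ ≷ 0}`).  **Everything here is proved; no definitions, no named facts.**

The flat charts of `(F, δ)` that the differential topology produces come *per disc*: the
thickening chart of the compressing disc `D_q` at `p ∈ δ = ∂D_q`
(`Literature/Analysis/Calculus/ThickenedImmersionChart.lean`, after the odd reflection of
`Literature/Analysis/Calculus/OddReflection.lean`) straightens `δ` inside `F` and exhibits the
sign pattern of `sd_q` — but the three discs give three different charts at `p`.  This file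
removes the discrepancy by general topology:

* `exists_signPattern_of_flatCharts` — **transfer of a sign pattern between flat charts.**  Let
  `e`, `e'` be open partial homeomorphisms from `Y` to `ℝ × ℝ` at `p` (`e p = e' p = 0`) both
  flattening `δ` (`δ ∩ source = {second coordinate = 0}`), and let `σ` be locally constant at
  the points of `e.source ∖ δ`.  If `σ = ε'` on `{e'₂ > 0}` and `σ = -ε'` on `{e'₂ < 0}`
  (`ε' = ±1`), then for some `r > 0` and `ε = ±1` one has `σ = ε` on `{e₂ > 0}` and `σ = -ε`
  on `{e₂ < 0}` over the ball of radius `r` of the chart `e`.  (The two open half-balls of `e`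
  are connected, so `σ` is constant on each, with values `c⁺`, `c⁻`; both `e'`-sides accumulate
  at `p`, so both values `ε'` and `-ε'` occur among `{c⁺, c⁻}`, whence `c⁻ = -c⁺`.)
* `IsGKTrisection.not_simplyConnectedSpace_of_sideChartsFamily` — the obstruction theorem with
  the chart hypothesis weakened to ONE FLAT CHART PER POINT AND PER DISC: for every `p ∈ δ` and
  every `q` a flat chart `e_{p,q}` of `(F, δ)` at `p` carrying the sign pattern of `sd_q` only.
  (Restrict `e_{p,0}` to `⋂_q O_q`, where every `sd_q` is locally constant off `δ` relative to
  the handlebody `H_q ⊇ F`, transfer the patterns of `sd_1`, `sd_2` to it, shrink to the smallest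
  of the three balls, and apply `…_of_sideCharts`.)

What is left for `Trisection.not_simplyConnectedSpace_of_reducing_nonseparating` after this
file is unchanged in substance (the side functions near the three discs and, per disc, a flat
chart of `(F, δ)` at each point of `δ` with that disc's sign pattern), but no compatibility
between the charts of different discs is required any more.

## References

* R. Aranda, A. Zupan, *Manifolds with weakly reducible genus-three trisections are standard*,
  arXiv:2503.04607 (2025), §2 p. 6 (reducing curves, non-separating case). [ArandaZupan2025]
* A. Hatcher, *Algebraic Topology*, CUP (2002), Thm. 1.7 (p. 29). [HatcherAT2002]
* S. Willard, *General Topology*, Addison–Wesley (1970), 26.15 (continuous images and unions of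
  connected sets).
-/

noncomputable section

open Set Function Filter Topology Metric
open scoped Manifold ContDiff

namespace Literature.Topology.FourManifolds

universe u

/-! ### Transfer of a sign pattern between two flat charts -/

section Transfer

variable {Y : Type*} [TopologicalSpace Y]

/-- A function which is locally constant at every point of a preconnected set is constant on
it. [folklore] -/
theorem eq_of_isPreconnected_of_eventuallyEq {P : Set Y} {f : Y → ℝ} (hP : IsPreconnected P)
    (hf : ∀ y ∈ P, ∀ᶠ z in 𝓝 y, f z = f y) {y₁ y₂ : Y} (h₁ : y₁ ∈ P) (h₂ : y₂ ∈ P) :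
    f y₂ = f y₁ := by
  classical
  set g : Y → Bool := fun y => decide (f y = f y₁) with hg
  have hgc : ContinuousOn g P := by
    intro y hy
    have hev : g =ᶠ[𝓝[P] y] fun _ => g y := by
      filter_upwards [mem_nhdsWithin_of_mem_nhds (hf y hy)] with z hz
      simp only [hg, hz]
    exact continuousWithinAt_const.congr_of_eventuallyEq hev rfl
  have h12 : g y₂ = g y₁ := hP.constant hgc h₂ h₁
  have h1 : g y₁ = true := by simp [hg]
  simpa [hg] using h12.trans h1

/-- The open upper half-ball of `ℝ × ℝ` is convex. [folklore] -/
theorem convex_ball_inter_snd_pos (r : ℝ) :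
    Convex ℝ (ball (0 : ℝ × ℝ) r ∩ {v : ℝ × ℝ | 0 < v.2}) :=
  (convex_ball _ _).inter
    (convex_halfSpace_gt (f := fun v : ℝ × ℝ => v.2) ⟨fun _ _ => rfl, fun _ _ => rfl⟩ 0)

/-- The open lower half-ball of `ℝ × ℝ` is convex. [folklore] -/
theorem convex_ball_inter_snd_neg (r : ℝ) :
    Convex ℝ (ball (0 : ℝ × ℝ) r ∩ {v : ℝ × ℝ | v.2 < 0}) :=
  (convex_ball _ _).inter
    (convex_halfSpace_lt (f := fun v : ℝ × ℝ => v.2) ⟨fun _ _ => rfl, fun _ _ => rfl⟩ 0)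

/-- The point `(0, t)` lies in the ball of radius `r` about `0` as soon as `|t| < r`.
[folklore] -/
theorem zero_mk_mem_ball {t r : ℝ} (ht : |t| < r) : ((0 : ℝ), t) ∈ ball (0 : ℝ × ℝ) r := by
  rw [mem_ball, Prod.dist_eq, Real.dist_eq, Real.dist_eq]
  simp only [Prod.fst_zero, Prod.snd_zero, sub_zero, abs_zero]
  exact max_lt (lt_of_le_of_lt (abs_nonneg t) ht) ht

/-- **Transfer of a sign pattern between two flat charts of `(Y, δ)` at a point.**  Let `e`,
`e'` be open partial homeomorphisms from `Y` to `ℝ × ℝ` with `p` in both sources,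
`e p = e' p = 0`, both *flattening* `δ` (a point of the source lies in `δ` iff its second
coordinate vanishes), and let `σ : Y → ℝ` be locally constant at every point of
`e.source ∖ δ`.  If `σ` has the sign pattern `σ = ε'` on `{e'₂ > 0}`, `σ = -ε'` on `{e'₂ < 0}`
in the chart `e'` (`ε' = ±1`), then it has a sign pattern `σ = ε` on `{e₂ > 0}`, `σ = -ε` on
`{e₂ < 0}` (`ε = ±1`) over a small ball of the chart `e`.  (The two open half-balls of `e` are
connected, so `σ` is constant on each; both sides of the chart `e'` accumulate at `p`, so both
values `±ε'` occur near `p` off `δ`, forcing the two constants to be opposite.) [folklore] -/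
theorem exists_signPattern_of_flatCharts {δ : Set Y} {σ : Y → ℝ} {p : Y}
    (e e' : OpenPartialHomeomorph Y (ℝ × ℝ)) (hp : p ∈ e.source) (hep : e p = 0)
    (hp' : p ∈ e'.source) (hep' : e' p = 0)
    (hδ : ∀ y ∈ e.source, y ∈ δ ↔ (e y).2 = 0) (hδ' : ∀ y ∈ e'.source, y ∈ δ ↔ (e' y).2 = 0)
    (hloc : ∀ y ∈ e.source, y ∉ δ → ∀ᶠ z in 𝓝 y, σ z = σ y)
    {ε' : ℝ} (hε' : ε' = 1 ∨ ε' = -1)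
    (hpat : ∀ y ∈ e'.source, (0 < (e' y).2 → σ y = ε') ∧ ((e' y).2 < 0 → σ y = -ε')) :
    ∃ r : ℝ, 0 < r ∧ ∃ ε : ℝ, (ε = 1 ∨ ε = -1) ∧ ∀ y ∈ e.source, e y ∈ ball (0 : ℝ × ℝ) r →
      (0 < (e y).2 → σ y = ε) ∧ ((e y).2 < 0 → σ y = -ε) := by
  -- a ball of the chart `e` over which `e⁻¹` lands in the source of `e'`
  set G : Set (ℝ × ℝ) := e.target ∩ e.symm ⁻¹' e'.source with hG
  have hGo : IsOpen G := e.continuousOn_symm.isOpen_inter_preimage e.open_target e'.open_source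
  have hsymm0 : e.symm 0 = p := by rw [← hep, e.left_inv hp]
  have h0G : (0 : ℝ × ℝ) ∈ G := by
    refine ⟨hep ▸ e.map_source hp, ?_⟩
    show e.symm 0 ∈ e'.source
    rw [hsymm0]
    exact hp'
  obtain ⟨r, hr, hball⟩ := Metric.isOpen_iff.1 hGo 0 h0G
  -- the two half-balls and their images
  set Up : Set (ℝ × ℝ) := ball (0 : ℝ × ℝ) r ∩ {v | 0 < v.2} with hUp
  set Um : Set (ℝ × ℝ) := ball (0 : ℝ × ℝ) r ∩ {v | v.2 < 0} with hUm
  have hUpt : Up ⊆ e.target := fun v hv => (hball hv.1).1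
  have hUmt : Um ⊆ e.target := fun v hv => (hball hv.1).1
  have hPp : IsPreconnected (e.symm '' Up) :=
    (convex_ball_inter_snd_pos r).isPreconnected.image _ (e.continuousOn_symm.mono hUpt)
  have hPm : IsPreconnected (e.symm '' Um) :=
    (convex_ball_inter_snd_neg r).isPreconnected.image _ (e.continuousOn_symm.mono hUmt)
  -- points over the ball: in the source of both charts, with `e (e⁻¹ v) = v`
  have hsrc : ∀ v ∈ ball (0 : ℝ × ℝ) r, e.symm v ∈ e.source ∧ e (e.symm v) = v ∧
      e.symm v ∈ e'.source := fun v hv =>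
    ⟨e.map_target (hball hv).1, e.right_inv (hball hv).1, (hball hv).2⟩
  -- `σ` is locally constant on both images (they avoid `δ`)
  have hlocP : ∀ v ∈ ball (0 : ℝ × ℝ) r, v.2 ≠ 0 → ∀ᶠ z in 𝓝 (e.symm v), σ z = σ (e.symm v) := by
    intro v hv hv2
    obtain ⟨hs, hev, -⟩ := hsrc v hv
    refine hloc _ hs fun hδv => hv2 ?_
    have h0 := (hδ _ hs).1 hδv
    rwa [hev] at h0
  -- hence constant on each image
  set vp : ℝ × ℝ := ((0 : ℝ), r / 2) with hvp
  set vm : ℝ × ℝ := ((0 : ℝ), -(r / 2)) with hvm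
  have hvpb : vp ∈ ball (0 : ℝ × ℝ) r :=
    zero_mk_mem_ball (by rw [abs_of_pos (by positivity)]; linarith)
  have hvmb : vm ∈ ball (0 : ℝ × ℝ) r :=
    zero_mk_mem_ball (by rw [abs_neg, abs_of_pos (by positivity)]; linarith)
  have hvpU : vp ∈ Up := ⟨hvpb, show (0 : ℝ) < r / 2 by positivity⟩
  have hvmU : vm ∈ Um := ⟨hvmb, show -(r / 2) < (0 : ℝ) by linarith⟩
  set cp : ℝ := σ (e.symm vp) with hcp
  set cm : ℝ := σ (e.symm vm) with hcm
  have hconst_p : ∀ y ∈ e.source, e y ∈ ball (0 : ℝ × ℝ) r → 0 < (e y).2 → σ y = cp := by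
    intro y hy hyb hy2
    have hyU : e y ∈ Up := ⟨hyb, hy2⟩
    have hyP : y ∈ e.symm '' Up := ⟨e y, hyU, e.left_inv hy⟩
    refine eq_of_isPreconnected_of_eventuallyEq hPp (fun z hz => ?_) (mem_image_of_mem _ hvpU) hyP
    obtain ⟨v, hv, rfl⟩ := hz
    exact hlocP v hv.1 (show (0 : ℝ) < v.2 from hv.2).ne'
  have hconst_m : ∀ y ∈ e.source, e y ∈ ball (0 : ℝ × ℝ) r → (e y).2 < 0 → σ y = cm := by
    intro y hy hyb hy2
    have hyU : e y ∈ Um := ⟨hyb, hy2⟩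
    have hyP : y ∈ e.symm '' Um := ⟨e y, hyU, e.left_inv hy⟩
    refine eq_of_isPreconnected_of_eventuallyEq hPm (fun z hz => ?_) (mem_image_of_mem _ hvmU) hyP
    obtain ⟨v, hv, rfl⟩ := hz
    exact hlocP v hv.1 (show v.2 < (0 : ℝ) from hv.2).ne
  -- every value taken over the punctured ball is `cp` or `cm`
  have hval : ∀ y ∈ e.source, e y ∈ ball (0 : ℝ × ℝ) r → y ∉ δ → σ y = cp ∨ σ y = cm := by
    intro y hy hyb hyδ
    have h2 : (e y).2 ≠ 0 := fun h0 => hyδ ((hδ y hy).2 h0)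
    rcases lt_or_gt_of_ne h2 with hlt | hgt
    · exact Or.inr (hconst_m y hy hyb hlt)
    · exact Or.inl (hconst_p y hy hyb hgt)
  -- both `e'`-sides occur over the ball: points `e'⁻¹ (0, ±r'/2)`
  set M : Set (ℝ × ℝ) := e'.target ∩ e'.symm ⁻¹' (e.source ∩ e ⁻¹' ball (0 : ℝ × ℝ) r) with hM
  have hMo : IsOpen M :=
    e'.continuousOn_symm.isOpen_inter_preimage e'.open_target (e.isOpen_inter_preimage isOpen_ball)
  have hsymm0' : e'.symm 0 = p := by rw [← hep', e'.left_inv hp']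
  have h0M : (0 : ℝ × ℝ) ∈ M := by
    refine ⟨hep' ▸ e'.map_source hp', ?_⟩
    show e'.symm 0 ∈ e.source ∩ e ⁻¹' ball (0 : ℝ × ℝ) r
    rw [hsymm0']
    exact ⟨hp, by rw [mem_preimage, hep]; exact mem_ball_self hr⟩
  obtain ⟨r', hr', hball'⟩ := Metric.isOpen_iff.1 hMo 0 h0M
  have hocc : ∀ t : ℝ, |t| < r' → t ≠ 0 →
      ∃ y ∈ e.source, e y ∈ ball (0 : ℝ × ℝ) r ∧ y ∉ δ ∧ y ∈ e'.source ∧ (e' y).2 = t := by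
    intro t ht ht0
    have hw : ((0 : ℝ), t) ∈ M := hball' (zero_mk_mem_ball ht)
    refine ⟨e'.symm ((0 : ℝ), t), hw.2.1, hw.2.2, fun hyδ => ht0 ?_, e'.map_target hw.1, ?_⟩
    · have h2 := (hδ' _ (e'.map_target hw.1)).1 hyδ
      rw [e'.right_inv hw.1] at h2
      simpa using h2
    · rw [e'.right_inv hw.1]
  have hr'h : (0 : ℝ) < r' / 2 := by positivity
  have hr'2 : |r' / 2| < r' := by rw [abs_of_pos hr'h]; linarith
  have hr'2' : |-(r' / 2)| < r' := by rw [abs_neg]; exact hr'2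
  obtain ⟨yp, hyp, hypb, hypδ, hyp', hyp2⟩ := hocc (r' / 2) hr'2 hr'h.ne'
  obtain ⟨ym, hym, hymb, hymδ, hym', hym2⟩ := hocc (-(r' / 2)) hr'2' (neg_ne_zero.2 hr'h.ne')
  have hσp : σ yp = ε' := (hpat yp hyp').1 (by rw [hyp2]; exact hr'h)
  have hσm : σ ym = -ε' := (hpat ym hym').2 (by rw [hym2]; linarith)
  have hoccp : ε' = cp ∨ ε' = cm := by rw [← hσp]; exact hval yp hyp hypb hypδ
  have hoccm : -ε' = cp ∨ -ε' = cm := by rw [← hσm]; exact hval ym hym hymb hymδ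
  have hε'0 : ε' ≠ 0 := by rcases hε' with h1 | h1 <;> rw [h1] <;> norm_num
  -- hence `cm = -cp` and `cp = ±1`
  have hcm_eq : cm = -cp := by
    rcases hoccp with h1 | h1 <;> rcases hoccm with h2 | h2
    · exfalso; exact hε'0 (by linarith [h1.trans h2.symm])
    · rw [← h2, ← h1]
    · rw [← h1, ← h2, neg_neg]
    · exfalso; exact hε'0 (by linarith [h1.trans h2.symm])
  have hcp1 : cp = 1 ∨ cp = -1 := by
    rcases hoccp with h1 | h1
    · rw [← h1]; exact hε'
    · have h3 : cp = -ε' := by rw [h1, hcm_eq, neg_neg]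
      rw [h3]
      rcases hε' with h2 | h2 <;> rw [h2] <;> norm_num
  refine ⟨r, hr, cp, hcp1, fun y hy hyb => ⟨fun hy2 => hconst_p y hy hyb hy2, fun hy2 => ?_⟩⟩
  rw [hconst_m y hy hyb hy2, hcm_eq]

end Transfer

/-! ### The obstruction from per-disc flat charts -/

section Charts

variable {X : Type u} [TopologicalSpace X] [T2Space X] [SecondCountableTopology X]
  [ChartedSpace (EuclideanSpace ℝ (Fin 4)) X] {g : ℕ} {k : Fin 3 → ℕ} {S : Fin 3 → Set X}

/-- **The `π₁`-obstruction to a non-separating reducing curve, from side functions and PER-DISC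
flat charts of `(F, δ)`.**  As `IsGKTrisection.not_simplyConnectedSpace_of_sideCharts`, except
that at each point `p ∈ δ` one flat chart of the central surface `F` straightening `δ` is asked
for EACH `q` separately, carrying the sign pattern of the side function `sd_q` of the `q`-th
compressing disc only (the shape in which the thickening charts of the three discs deliver
them); the patterns are transported to a common chart by `exists_signPattern_of_flatCharts`.
See the module docstring.
[cite: ArandaZupan2025, §2 p. 6 (reducing curves, non-separating case)]
[cite: HatcherAT2002, Thm. 1.7 (p. 29)] -/
theorem IsGKTrisection.not_simplyConnectedSpace_of_sideChartsFamily (h : IsGKTrisection X g k S)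
    {δ : Set X} (hc : Trisection.IsCurve S δ) (hns : Trisection.IsNonSeparating S δ)
    (D : Fin 3 → Set X) (hDc : ∀ q, IsClosed (D q))
    (hDH : ∀ q, D q ⊆ Trisection.spineHandlebody S q)
    (hDF : ∀ q, D q ∩ (⋂ l, S l) = δ)
    (O : Fin 3 → Set X) (hO : ∀ q, IsOpen (O q)) (hDO : ∀ q, D q ⊆ O q)
    (sd : Fin 3 → X → ℝ)
    (hsd : ∀ q, ∀ y ∈ (O q ∩ Trisection.spineHandlebody S q) \ D q,
      (sd q y = 1 ∨ sd q y = -1) ∧ ∀ᶠ z in 𝓝[Trisection.spineHandlebody S q] y, sd q z = sd q y)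
    (hchart : ∀ p : ↥(⋂ l, S l), (p : X) ∈ δ → ∀ q : Fin 3,
      ∃ e : OpenPartialHomeomorph ↥(⋂ l, S l) (ℝ × ℝ), p ∈ e.source ∧ e p = 0 ∧
        (∀ y ∈ e.source, (y : X) ∈ δ ↔ (e y).2 = 0) ∧
        ∃ ε : ℝ, (ε = 1 ∨ ε = -1) ∧ ∀ y ∈ e.source,
          (0 < (e y).2 → sd q y = ε) ∧ ((e y).2 < 0 → sd q y = -ε)) :
    ¬ SimplyConnectedSpace X := by
  classical
  -- elementary facts
  have hFH : ∀ q, (⋂ l, S l) ⊆ Trisection.spineHandlebody S q := fun q =>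
    iInter_subset_spineHandlebody S q
  have hδD : ∀ q, δ ⊆ D q := fun q y hy => by
    have : y ∈ D q ∩ ⋂ l, S l := by rw [hDF q]; exact hy
    exact this.1
  have hnotD : ∀ q, ∀ y ∈ ⋂ l, S l, y ∉ δ → y ∉ D q := fun q y hyF hyδ hyD => by
    have : y ∈ D q ∩ ⋂ l, S l := ⟨hyD, hyF⟩
    rw [hDF q] at this
    exact hyδ this
  -- each `sd q` is locally constant, in the subspace `F`, at the points of `F ∩ O_q` off `δ`
  have hlocq : ∀ q, ∀ y : ↥(⋂ l, S l), (y : X) ∈ O q → (y : X) ∉ δ →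
      ∀ᶠ z : ↥(⋂ l, S l) in 𝓝 y, sd q z = sd q y := by
    intro q y hyO hyδ
    obtain ⟨-, hev⟩ := hsd q y ⟨⟨hyO, hFH q y.2⟩, hnotD q y y.2 hyδ⟩
    obtain ⟨t, ht, hto, hyt⟩ := eventually_nhds_iff.1 (eventually_nhdsWithin_iff.1 hev)
    filter_upwards [(hto.preimage continuous_subtype_val).mem_nhds hyt] with z hz
    exact ht z hz (hFH q z.2)
  refine h.not_simplyConnectedSpace_of_sideCharts hc hns D hDc hDH hDF O hO hDO sd hsd
    fun p hp => ?_
  -- the chart of the disc `0` at `p`, restricted to `⋂ q, O q`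
  obtain ⟨e₀, hpe₀, he₀p, hδe₀, -⟩ := hchart p hp 0
  set Ω : Set ↥(⋂ l, S l) := Subtype.val ⁻¹' ⋂ q, O q with hΩ
  have hΩo : IsOpen Ω := (isOpen_iInter_of_finite hO).preimage continuous_subtype_val
  have hpΩ : p ∈ Ω := mem_iInter.2 fun q => hDO q (hδD q hp)
  set e : OpenPartialHomeomorph ↥(⋂ l, S l) (ℝ × ℝ) := e₀.restrOpen Ω hΩo with he
  have hes : e.source = e₀.source ∩ Ω := e₀.restrOpen_source Ω hΩo
  have hecoe : (e : ↥(⋂ l, S l) → ℝ × ℝ) = e₀ := by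
    rw [he, OpenPartialHomeomorph.coe_restrOpen]
  have hpe : p ∈ e.source := by rw [hes]; exact ⟨hpe₀, hpΩ⟩
  have hep : e p = 0 := by rw [hecoe]; exact he₀p
  have hδe : ∀ y ∈ e.source, (y : X) ∈ δ ↔ (e y).2 = 0 := fun y hy => by
    rw [hecoe]
    rw [hes] at hy
    exact hδe₀ y hy.1
  have hloc : ∀ q, ∀ y ∈ e.source, y ∉ (Subtype.val ⁻¹' δ : Set ↥(⋂ l, S l)) →
      ∀ᶠ z : ↥(⋂ l, S l) in 𝓝 y, sd q z = sd q y := fun q y hy hyδ => by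
    rw [hes] at hy
    exact hlocq q y (mem_iInter.1 hy.2 q) hyδ
  -- transfer the three sign patterns to `e`
  have htrans : ∀ q, ∃ r : ℝ, 0 < r ∧ ∃ ε : ℝ, (ε = 1 ∨ ε = -1) ∧ ∀ y ∈ e.source,
      e y ∈ ball (0 : ℝ × ℝ) r → (0 < (e y).2 → sd q y = ε) ∧ ((e y).2 < 0 → sd q y = -ε) := by
    intro q
    obtain ⟨e', hpe', he'p, hδe', ε', hε', hpat'⟩ := hchart p hp q
    exact exists_signPattern_of_flatCharts (δ := (Subtype.val ⁻¹' δ : Set ↥(⋂ l, S l)))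
      (σ := fun y => sd q y) e e' hpe hep hpe' he'p hδe hδe' (hloc q) hε' hpat'
  choose r hr ε hε hpat using htrans
  set r₀ : ℝ := min (r 0) (min (r 1) (r 2)) with hr₀
  have hr₀pos : 0 < r₀ := lt_min (hr 0) (lt_min (hr 1) (hr 2))
  have hr₀le : ∀ q, r₀ ≤ r q := fun q => by
    fin_cases q <;> simp [hr₀]
  -- the common chart: `e` over the smallest ball
  set B : Set ↥(⋂ l, S l) := e.source ∩ e ⁻¹' ball (0 : ℝ × ℝ) r₀ with hB
  have hBo : IsOpen B := e.isOpen_inter_preimage isOpen_ball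
  refine ⟨e.restrOpen B hBo, ?_, hep, fun y hy => hδe y ?_, fun q => ⟨ε q, hε q, fun y hy => ?_⟩⟩
  · rw [e.restrOpen_source]
    exact ⟨hpe, hpe, by rw [mem_preimage, hep]; exact mem_ball_self hr₀pos⟩
  · rw [e.restrOpen_source] at hy
    exact hy.1
  · rw [e.restrOpen_source] at hy
    exact hpat q y hy.1 (ball_subset_ball (hr₀le q) hy.2.2)

end Charts

end Literature.Topology.FourManifolds

end
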